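import Literature.AlgebraicGeometry.Resolution.WeightedResolutionDatum
import Literature.AlgebraicGeometry.Resolution.Principalization
import Mathlib.AlgebraicGeometry.Properties
import HarnessLib

/-!
# Hypersurface resolution data — the datum interface restricted to integral hypersurfaces

Route `ResolutionOfSingularities/WeightedInvariant`, crux `Theses.WeightedInvariant.WeightedThesis`
(stmt-ResolutionOfSingularities-0569: resolution of every reduced separated scheme of finite type over
every perfect field of characteristic `p`), line `datum-glued-split`, lead c7, RESHAPE 7.

The line has shown that the route's composition consumes a weighted resolution datum
(`Literature.AlgebraicGeometry.Resolution.WeightedResolutionDatum p`, the interface whose inhabitation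
is the construction crux `WeightedConstruction`, stmt-0571) ONLY on pairs `(Y, X)` with `X` an integral
HYPERSURFACE of the smooth separated quasi-compact `Y` (`Theorems/…HypersurfacesIff.lean`,
`weightedThesis_iff_hypersurfaces`: the crux is equivalent to the resolution of integral hypersurfaces),
and Włodarczyk's cobordant tower never leaves that class (the strict transform of a hypersurface on the
regular cobordant blow-up is a hypersurface, `Theorems/…PrincipalStrictTransform.lean`; the strict
transform of an integral subscheme is integral, `Theorems/…DatumToEmbeddedStrictTransform.lean`). This
file posits the correspondingly WEAKER interface — an object of the line, in the manner of the pre-data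
of the sibling crux (`Theorems/…PreDatumReduction.lean`, `…StaticDefs.lean`):

* `HypersurfaceResolutionDatum p` — the data of `WeightedResolutionDatum p` verbatim (one well-ordered
  `Γ`; total `inv`, `centre`) and its axioms `(usc)`, `(i)`, `(ii)`, `(iii)`, `(iv)` verbatim, but each
  demanded only for ideal sheaves `X` that are LOCALLY PRINCIPAL (`IsLocallyPrincipal`,
  `Literature/…/Principalization.lean`, Stacks 01WR) with INTEGRAL closed subscheme `X.subscheme`;
* `HypersurfaceResolutionDatum.ofDatum` — every datum is a hypersurface datum (forget), so
  `WeightedConstruction` implies `∀ p prime, Nonempty (HypersurfaceResolutionDatum p)`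
  (`nonempty_hypersurfaceResolutionDatum_of_nonempty`);
* `isLocallyPrincipal_of_forall_isPrincipal` / `forall_isPrincipal_of_isLocallyPrincipal` (the line's
  spelling of "hypersurface" — an affine neighbourhood on which the ideal is principal — is Stacks').
  (The datum's small API — `not_isBot_of_isMaxOn`, `support_centre_subset`, … — is re-proved inline
  where the tower needs it; as separate lemmas it would duplicate the Literature statements.)

The tower for this interface (hypersurface datum + Bergh–Rydh over `k` ⇒ resolution of integral
hypersurfaces over `k` ⇒ `WeightedThesis`) is landed in the sibling files
`Theorems/WeightedInvariantWeightedThesisHypersurfaceTower*.lean`. This is door (α) of the construction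
crux's strategy census (`Cruxes/WeightedConstruction/STRATEGY-CENSUS.md` §6): the typed restatement
target "datum on locally principal ideal sheaves" with its consumer side proved.
-/

noncomputable section

open CategoryTheory AlgebraicGeometry TopologicalSpace
open Literature.AlgebraicGeometry.Resolution

set_option linter.dupNamespace false -- mandated namespace of this single-conjunct summit

namespace Summit.ResolutionOfSingularities.ResolutionOfSingularities.Theorems

/-- The line's spelling of "`X` is a hypersurface" — every point has an affine neighbourhood on which
the ideal of `X` is principal — implies `IsLocallyPrincipal X` (Stacks 01WR). [folklore] -/
theorem isLocallyPrincipal_of_forall_isPrincipal : ∀ {Y : AlgebraicGeometry.Scheme.{0}} {X : Y.IdealSheafData}, (∀ y : Y, ∃ U : Y.affineOpens, y ∈ (U : Y.Opens) ∧ (X.ideal U).IsPrincipal) → Literature.AlgebraicGeometry.Resolution.IsLocallyPrincipal X := by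
  intro Y X h y
  obtain ⟨U, hyU, hU⟩ := h y
  obtain ⟨g, hg⟩ := hU
  exact ⟨U, hyU, g, hg⟩

/-- Conversely `IsLocallyPrincipal X` gives the line's spelling. [folklore] -/
theorem forall_isPrincipal_of_isLocallyPrincipal {Y : Scheme.{0}} {X : Y.IdealSheafData}
    (h : IsLocallyPrincipal X) :
    ∀ y : Y, ∃ U : Y.affineOpens, y ∈ (U : Y.Opens) ∧ (X.ideal U).IsPrincipal := fun y => by
  obtain ⟨U, hyU, g, hg⟩ := h y
  exact ⟨U, hyU, ⟨g, hg⟩⟩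

/-- **Hypersurface resolution datum in characteristic `p`** (object posited by line `datum-glued-split`
of crux `WeightedThesis`, RESHAPE 7): the data of a weighted resolution datum
(`Literature.AlgebraicGeometry.Resolution.WeightedResolutionDatum p`: one linearly ordered well-founded
value type `Γ`; for every field `k`, every `k`-scheme `f : Y → Spec k` and every ideal sheaf `X` on `Y`
a TOTAL rating `inv f X : Y → Γ` and a Rees algebra `centre f X` on `Y`) and its axioms `(usc)` closed
superlevel sets, `(i)` functoriality of `inv` for smooth `k`-morphisms and perfect ground-field
extensions and of `centre` for smooth surjective `k`-morphisms and such extensions, `(ii)` `inv`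
minimal exactly off `X` and at the regular points of `X`, `(iii)` (guard: `inv` not everywhere minimal)
the centre is a regular weighted centre supported exactly on the maximum locus, `(iv)` (same guard) on
the cobordant blow-up `B₊(U)` of every affine chart, with the strict transform, `inv` is everywhere
strictly below `max_Y inv` — ALL DEMANDED ONLY for `X` LOCALLY PRINCIPAL with INTEGRAL closed
subscheme `X.subscheme` (an integral hypersurface of `Y`), the only pairs the route's tower visits.
Shape: Abramovich–Temkin–Włodarczyk 2024 Thm. 1.1.1 and Włodarczyk arXiv:2203.03090 §3.3.33,
Thm. 4.3.1, restricted to hypersurfaces. EVIDENCE, not a claim. -/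
structure HypersurfaceResolutionDatum (p : ℕ) : Type 1 where
  /-- the value set of the invariant (one for all dimensions) -/
  Γ : Type
  /-- `Γ` is linearly ordered … -/
  [linearOrder : LinearOrder Γ]
  /-- … and well-ordered -/
  [wellFoundedLT : WellFoundedLT Γ]
  /-- the invariant `inv_{(Y,X)} : |Y| → Γ` (total; constrained only for `k` perfect of char `p`,
  `f` smooth separated quasi-compact, `X` an integral hypersurface) -/
  inv : ∀ ⦃k : Type⦄ [Field k] ⦃Y : Scheme.{0}⦄, (Y ⟶ Spec (.of k)) → Y.IdealSheafData → Y → Γ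
  /-- the weighted centre of `(Y, X)`, as a Rees algebra on `Y` (total) -/
  centre : ∀ ⦃k : Type⦄ [Field k] ⦃Y : Scheme.{0}⦄, (Y ⟶ Spec (.of k)) → Y.IdealSheafData →
    ReesAlgebraData Y
  /-- `(usc)` [hypersurface pairs] superlevel sets are closed -/
  isClosed_superlevel : ∀ ⦃k : Type⦄ [Field k] [CharP k p] [PerfectField k] ⦃Y : Scheme.{0}⦄
    (f : Y ⟶ Spec (.of k)) [Smooth f] [IsSeparated f] [QuasiCompact f] (X : Y.IdealSheafData),
    IsLocallyPrincipal X → IsIntegral X.subscheme →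
    ∀ (γ : Γ), IsClosed {y : Y | γ ≤ inv f X y}
  /-- `(i)` [hypersurface pairs] functoriality of `inv` for smooth `k`-morphisms `g : Y₁ → Y` -/
  inv_comap : ∀ ⦃k : Type⦄ [Field k] [CharP k p] [PerfectField k] ⦃Y Y₁ : Scheme.{0}⦄
    (f : Y ⟶ Spec (.of k)) [Smooth f] [IsSeparated f] [QuasiCompact f]
    (f₁ : Y₁ ⟶ Spec (.of k)) [Smooth f₁] [IsSeparated f₁] [QuasiCompact f₁]
    (g : Y₁ ⟶ Y) [Smooth g], g ≫ f = f₁ →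
    ∀ (X : Y.IdealSheafData), IsLocallyPrincipal X → IsIntegral X.subscheme →
    ∀ (y₁ : Y₁), inv f₁ (X.comap g) y₁ = inv f X (g y₁)
  /-- `(i)` [hypersurface pairs] functoriality of `inv` for extensions of perfect ground fields -/
  inv_baseChange : ∀ ⦃k : Type⦄ [Field k] [CharP k p] [PerfectField k]
    ⦃K : Type⦄ [Field K] [PerfectField K] (φ : k →+* K)
    ⦃Y YK : Scheme.{0}⦄ (f : Y ⟶ Spec (.of k)) [Smooth f] [IsSeparated f] [QuasiCompact f]
    (fK : YK ⟶ Spec (.of K)) (pr : YK ⟶ Y),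
    IsPullback pr fK f (Spec.map (CommRingCat.ofHom φ)) →
    ∀ (X : Y.IdealSheafData), IsLocallyPrincipal X → IsIntegral X.subscheme →
    ∀ (y : YK), inv fK (X.comap pr) y = inv f X (pr y)
  /-- `(ii)` [hypersurface pairs] `inv` is minimal at `y` iff `y ∉ X` or `𝒪_{X,y}` is regular -/
  isBot_inv_iff : ∀ ⦃k : Type⦄ [Field k] [CharP k p] [PerfectField k] ⦃Y : Scheme.{0}⦄
    (f : Y ⟶ Spec (.of k)) [Smooth f] [IsSeparated f] [QuasiCompact f] (X : Y.IdealSheafData),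
    IsLocallyPrincipal X → IsIntegral X.subscheme →
    ∀ (y : Y), IsBot (inv f X y) ↔
      ∀ x : X.subscheme, X.subschemeι x = y → IsRegularLocalRing (X.subscheme.presheaf.stalk x)
  /-- `(iii)` [hypersurface pairs; guard] the centre is a regular weighted centre … -/
  isRegularWeightedCentre_centre : ∀ ⦃k : Type⦄ [Field k] [CharP k p] [PerfectField k]
    ⦃Y : Scheme.{0}⦄ (f : Y ⟶ Spec (.of k)) [Smooth f] [IsSeparated f] [QuasiCompact f]
    (X : Y.IdealSheafData), IsLocallyPrincipal X → IsIntegral X.subscheme →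
    (∃ y : Y, ¬ IsBot (inv f X y)) → (centre f X).IsRegularWeightedCentre
  /-- `(iii)` [hypersurface pairs; guard] … supported exactly on the maximum locus of `inv` -/
  support_centre : ∀ ⦃k : Type⦄ [Field k] [CharP k p] [PerfectField k]
    ⦃Y : Scheme.{0}⦄ (f : Y ⟶ Spec (.of k)) [Smooth f] [IsSeparated f] [QuasiCompact f]
    (X : Y.IdealSheafData), IsLocallyPrincipal X → IsIntegral X.subscheme →
    (∃ y : Y, ¬ IsBot (inv f X y)) →
    (centre f X).support = {y : Y | ∀ y' : Y, inv f X y' ≤ inv f X y}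
  /-- `(i)` for the centre [hypersurface pairs; guard]: smooth SURJECTIVE `k`-morphisms -/
  centre_comap : ∀ ⦃k : Type⦄ [Field k] [CharP k p] [PerfectField k] ⦃Y Y₁ : Scheme.{0}⦄
    (f : Y ⟶ Spec (.of k)) [Smooth f] [IsSeparated f] [QuasiCompact f]
    (f₁ : Y₁ ⟶ Spec (.of k)) [Smooth f₁] [IsSeparated f₁] [QuasiCompact f₁]
    (g : Y₁ ⟶ Y) [Smooth g] [Surjective g], g ≫ f = f₁ →
    ∀ (X : Y.IdealSheafData), IsLocallyPrincipal X → IsIntegral X.subscheme →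
    (∃ y : Y, ¬ IsBot (inv f X y)) →
    ∀ n : ℕ, (centre f₁ (X.comap g)).piece n = ((centre f X).piece n).comap g
  /-- `(i)` for the centre [hypersurface pairs; guard]: extensions of perfect ground fields -/
  centre_baseChange : ∀ ⦃k : Type⦄ [Field k] [CharP k p] [PerfectField k]
    ⦃K : Type⦄ [Field K] [PerfectField K] (φ : k →+* K)
    ⦃Y YK : Scheme.{0}⦄ (f : Y ⟶ Spec (.of k)) [Smooth f] [IsSeparated f] [QuasiCompact f]
    (fK : YK ⟶ Spec (.of K)) (pr : YK ⟶ Y),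
    IsPullback pr fK f (Spec.map (CommRingCat.ofHom φ)) →
    ∀ (X : Y.IdealSheafData), IsLocallyPrincipal X → IsIntegral X.subscheme →
    (∃ y : Y, ¬ IsBot (inv f X y)) →
    ∀ n : ℕ, (centre fK (X.comap pr)).piece n = ((centre f X).piece n).comap pr
  /-- `(iv)` [hypersurface pairs; guard] the invariant DROPS on the cobordant blow-up of every
  affine chart, with the strict transform, strictly below `max_Y inv` -/
  inv_cobordantPlus_lt : ∀ ⦃k : Type⦄ [Field k] [CharP k p] [PerfectField k]
    ⦃Y : Scheme.{0}⦄ (f : Y ⟶ Spec (.of k)) [Smooth f] [IsSeparated f] [QuasiCompact f]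
    (X : Y.IdealSheafData), IsLocallyPrincipal X → IsIntegral X.subscheme →
    (∃ y : Y, ¬ IsBot (inv f X y)) →
    ∀ (U : Y.affineOpens) (b : (centre f X).cobordantPlus U) (y : Y),
      (∀ y' : Y, inv f X y' ≤ inv f X y) →
      inv ((centre f X).cobordantPlusι U ≫ f) ((centre f X).cobordantStrictTransform U X) b
        < inv f X y

namespace HypersurfaceResolutionDatum

variable {p : ℕ} (D : HypersurfaceResolutionDatum p)

/-- The value set is linearly ordered (structure field as an instance). [folklore] -/
instance instLinearOrder : LinearOrder D.Γ := D.linearOrder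

/-- The value set is well-ordered (structure field as an instance). [folklore] -/
instance instWellFoundedLT : WellFoundedLT D.Γ := D.wellFoundedLT

/-- **Every weighted resolution datum is a hypersurface resolution datum** (forget the axioms on
non-hypersurface pairs): `Γ`, `inv`, `centre` are kept. [folklore] -/
def ofDatum (D : WeightedResolutionDatum p) : HypersurfaceResolutionDatum p where
  Γ := D.Γ
  inv := D.inv
  centre := D.centre
  isClosed_superlevel := fun _ _ _ _ _ f _ _ _ X _ _ γ => D.isClosed_superlevel f X γ
  inv_comap := fun _ _ _ _ _ _ f _ _ _ f₁ _ _ _ g _ hg X _ _ y₁ => D.inv_comap f f₁ g hg X y₁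
  inv_baseChange := fun _ _ _ _ _ _ _ φ _ _ f _ _ _ fK pr h X _ _ y =>
    D.inv_baseChange φ f fK pr h X y
  isBot_inv_iff := fun _ _ _ _ _ f _ _ _ X _ _ y => D.isBot_inv_iff f X y
  isRegularWeightedCentre_centre := fun _ _ _ _ _ f _ _ _ X _ _ h =>
    D.isRegularWeightedCentre_centre f X h
  support_centre := fun _ _ _ _ _ f _ _ _ X _ _ h => D.support_centre f X h
  centre_comap := fun _ _ _ _ _ _ f _ _ _ f₁ _ _ _ g _ _ hg X _ _ h n =>
    D.centre_comap f f₁ g hg X h n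
  centre_baseChange := fun _ _ _ _ _ _ _ φ _ _ f _ _ _ fK pr hpb X _ _ h n =>
    D.centre_baseChange φ f fK pr hpb X h n
  inv_cobordantPlus_lt := fun _ _ _ _ _ f _ _ _ X _ _ h U b y hy =>
    D.inv_cobordantPlus_lt f X h U b y hy

/-- `ofDatum` keeps the value set. [folklore] -/
@[simp] theorem ofDatum_Γ (D : WeightedResolutionDatum p) : (ofDatum D).Γ = D.Γ := rfl

/-- `ofDatum` keeps the invariant. [folklore] -/
@[simp] theorem ofDatum_inv (D : WeightedResolutionDatum p) : (ofDatum D).inv = D.inv := rfl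

/-- `ofDatum` keeps the centre. [folklore] -/
@[simp] theorem ofDatum_centre (D : WeightedResolutionDatum p) : (ofDatum D).centre = D.centre := rfl

/-- **`WeightedConstruction` implies the hypersurface construction**: a weighted resolution datum in
characteristic `p` gives a hypersurface resolution datum in characteristic `p`. [folklore] -/
theorem nonempty_of_nonempty_datum (h : Nonempty (WeightedResolutionDatum p)) :
    Nonempty (HypersurfaceResolutionDatum p) :=
  h.map ofDatum

end HypersurfaceResolutionDatum

end Summit.ResolutionOfSingularities.ResolutionOfSingularities.Theorems

end
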